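import Mathlib
import Summits.Ventures.DiscreteObjects.Mahler.CensusKernelDeg24Tables
import Summits.Ventures.DiscreteObjects.Mahler.CensusAuxCutMono
import Summits.Ventures.DiscreteObjects.Mahler.AuxCut24P1Pos
import Summits.Ventures.DiscreteObjects.Mahler.AuxCut24P1Neg
import Summits.Ventures.DiscreteObjects.Mahler.AuxCut24Lb2Pos
import Summits.Ventures.DiscreteObjects.Mahler.AuxCut24Lb2Neg
import Summits.Ventures.DiscreteObjects.Mahler.AuxCut24P3Pos
import Summits.Ventures.DiscreteObjects.Mahler.AuxCut24P3Neg
import Summits.Ventures.DiscreteObjects.Mahler.AuxCut24N4Pos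
import Summits.Ventures.DiscreteObjects.Mahler.AuxCut24P4Neg
import Summits.Ventures.DiscreteObjects.Mahler.AuxCut24L5Pos
import Summits.Ventures.DiscreteObjects.Mahler.AuxCut24L5Neg
import Summits.Ventures.DiscreteObjects.Mahler.AuxCut24M6Pos
import Summits.Ventures.DiscreteObjects.Mahler.AuxCut24M7Pos
import Summits.Ventures.DiscreteObjects.Mahler.AuxCut24M7Neg
import Summits.Ventures.DiscreteObjects.Mahler.AuxCut24N8Pos
import Summits.Ventures.DiscreteObjects.Mahler.AuxCut24M8Neg
import Summits.Ventures.DiscreteObjects.Mahler.AuxCut24L9Pos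
import Summits.Ventures.DiscreteObjects.Mahler.AuxCut24L9Neg
import Summits.Ventures.DiscreteObjects.Mahler.AuxCut24M10Pos
import Summits.Ventures.DiscreteObjects.Mahler.AuxCut24M10Neg
import Summits.Ventures.DiscreteObjects.Mahler.AuxCut24L11Pos
import Summits.Ventures.DiscreteObjects.Mahler.AuxCut24L11Neg
import Summits.Ventures.DiscreteObjects.Mahler.AuxCut24M12Neg
import Summits.Ventures.DiscreteObjects.Mahler.AuxCut24M13Pos
import Summits.Ventures.DiscreteObjects.Mahler.AuxCut24M13Neg
import Summits.Ventures.DiscreteObjects.Mahler.AuxCut24P14Pos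
import Summits.Ventures.DiscreteObjects.Mahler.AuxCut24M14Neg
import Summits.Ventures.DiscreteObjects.Mahler.AuxCut24M15Pos
import Summits.Ventures.DiscreteObjects.Mahler.AuxCut24M15Neg
import Summits.Ventures.DiscreteObjects.Mahler.AuxCut24M16Neg
import Summits.Ventures.DiscreteObjects.Mahler.AuxCut24M17Pos
import Summits.Ventures.DiscreteObjects.Mahler.AuxCut24M17Neg
import Summits.Ventures.DiscreteObjects.Mahler.AuxCut24M20Neg
import Summits.Ventures.DiscreteObjects.Mahler.AuxCut24N12Pos
import Summits.Ventures.DiscreteObjects.Mahler.AuxCut24L6Neg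
import Summits.Ventures.DiscreteObjects.Mahler.AuxCut24L16Pos
import Summits.Ventures.DiscreteObjects.Mahler.AuxCut24N20Pos
import Summits.Ventures.DiscreteObjects.Mahler.CensusKernelDeg24NL1
import Summits.Ventures.DiscreteObjects.Mahler.CensusKernelDeg24NL2
import Summits.Ventures.DiscreteObjects.Mahler.SubLehmerDegreeTwentyFour
import Summits.Ventures.DiscreteObjects.Mahler.CensusRows24Kernel
import Summits.Ventures.DiscreteObjects.Mahler.CensusListedLehmerMinimum

/-!
# Degree-24 kernel census at the Lehmer bound and Lehmer's conjecture for every integer polynomial of degree ≤ 25 (venture `DiscreteObjects`, target L)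

Cell `pub-namedobj`, seats `pub-namedobj-mahler-g18` (census, thresholds, assembly), `g21` (re-wiring to landed certificate
files), `g26` (this merged file: the former part `CensusKernelDeg24A` — validity of the thresholds and of the combined cut table —
and the assembly `SubLehmerDegreeTwentySix` in ONE module, every certified cut now imported from its landed single-file or chain
certificate `AuxCut24…`, no composition from segments; texts of the statements unchanged).  Framing: lottery ticket; floor = certified bounds/negative ranges.

PART A (validity).  `DegreeCensus 24 (20/17) coresDeg24` is a THEOREM of the Lean kernel (standard axioms; `decide` with kernel
reduction, no `native_decide`), by the census search `censusSearchC` (mahler g12/g13) with a COMBINED cut table — the Fejér–Riesz /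
RESULTANT cuts (`CT24tr`, mahler g13/g14; validity by `decide`) AND the kernel-certified EXPLICIT-AUXILIARY-FUNCTION unit cuts
(`CT24al`: `|P_1| ≤ 2`, `|P_2| ≤ 3`, `|P_3| ≤ 5`, `-5 ≤ P_4 ≤ 6`, `|P_5| ≤ 8`, `|P_6| ≤ 7`, `|P_7| ≤ 10`, `-9 ≤ P_8 ≤ 11`, `|P_9| ≤ 16`,
`|P_10| ≤ 13`, `|P_11| ≤ 18`, `-14 ≤ P_12 ≤ 19`; files `AuxCut24L/M/N…` certified at `20/17` (mahler g18/g19/g21), files `AuxCut24P…`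
certified at `61/50` (mahler g17) and transported to `20/17` by monotonicity, `CensusAuxCutMono`) — and EXTENDED leaf thresholds
(`ThresholdsValidX`, mahler g15) from the certified unit cuts at `k ∈ [13, 14, 15, 16, 17, 20]`.  The bound is the LEHMER bound
`B = 20/17 = 1.17647… > 1.17629 > M(ℓ)`: below every known measure `> 1` other than `M(ℓ)` itself, so the row is EMPTY up to the `exc`
certificates of listed cores (all `M > 1.1883`).  The search leaves 594073 leaves with `c_1 ≥ 0` and 36330 survivors, each discharged
by an EXTENDED certificate `CertX` (`CensusCertificateX`: `base (red/cyc/exc)` or the trace–Graeffe rejection `tgr m k`); the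
exception list is the full 57-entry list `coresDeg24` (46 primitive + 11 imprimitive), up to `x ↦ -x`.  Tables: `CensusKernelDeg24Tables`;
one kernel check per search node in the parts `CensusKernelDeg24P001–P067`, assembled by the node-lemma files `NL1`, `NL2`.

PART B (assembly and corollaries).  `certified24` (every survivor with `c₁ ≥ 0` carries a valid certificate) ⇒
`degreeCensus_twentyfour : DegreeCensus 24 (20/17) coresDeg24` by `degreeCensus_of_certified_nonnegXC` (`x ↦ -x` symmetry); then
* `degreeCensus_twentyfour_lehmer : DegreeCensus 24 (20/17) []` — the row is EMPTY (`coresDeg24_gap`);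
* `lehmer_le_of_irreducible_degree_twentyfour`, `lehmer_le_of_irreducible_of_natDegree_le_twentyfive`,
  `lehmer_le_of_natDegree_le_twentyfive` — every `P ∈ ℤ[X]` of degree `≤ 25` with `M(P) > 1` has `M(P) ≥ M(ℓ)`
  (odd degree 25: Smyth's theorem forces a reciprocal, hence even-degree, irreducible factor);
* `twentysix_le_natDegree_of_subLehmer` — `1 < M(P) < M(ℓ)` forces `deg P ≥ 26`; rungs `N ≤ 25` of the cell's sub-Lehmer ladder and
  every `HeightCell h s d` with `d ≤ 25`, unconditionally; `kernelCensus_le_twentyfive`.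
MRW08's row `D = 24` (`M_24 = 1.21885…`) is NOT re-derived here (it needs `B = 61/50`).  CONTROL/replication rows (published complete lists
reach degree 44: Boyd 1980/1989, Mossinghoff 1998, Flammang–Rhin–Sac-Épée 2006, Mossinghoff–Rhin–Wu 2008), not new ground.
-/

namespace Summit.Ventures.DiscreteObjects.Mahler

open Polynomial

/-- `1 ≤ 20/17` (cast form used by `CutValidAL.mono`). -/
theorem one_le_B24 : (1 : ℝ) ≤ (((20 / 17 : ℚ)) : ℝ) := by
  push_cast; norm_num

/-- `20/17 ≤ 61/50`: the bound of the reused certificates dominates the census bound. -/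
theorem B24_le_oldB : (((20 / 17 : ℚ)) : ℝ) ≤ (((61/50 : ℚ)) : ℝ) := by
  push_cast; norm_num

/-- **The thresholds are valid in the extended sense** for `B = 20/17`: elementary bound `T_k = ceil(2d-2+B^k+B^-k)-1` except for
`k ∈ [13, 14, 15, 16, 17, 20]`, where `T_k = max(N⁺, N⁻)` comes from the certified unit cuts `±P_k ≥ -N^±` (`AuxCut24L/P<k>Pos/Neg`, the latter
certified at `61/50` and transported by monotonicity). -/
theorem thresholdsValidX_T24 : ThresholdsValidX 12 (((20 : ℕ) : ℝ) / ((17 : ℕ) : ℝ)) T24 := by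
  intro k hk1 hk2
  have hk : k ≤ 30 := hk2
  interval_cases k
  · left; norm_num [T24]
  · left; norm_num [T24]
  · left; norm_num [T24]
  · left; norm_num [T24]
  · left; norm_num [T24]
  · left; norm_num [T24]
  · left; norm_num [T24]
  · left; norm_num [T24]
  · left; norm_num [T24]
  · left; norm_num [T24]
  · left; norm_num [T24]
  · left; norm_num [T24]
  · right
    rw [← ratCast_B24]
    exact ⟨21, 21, by norm_num [T24], by norm_num [T24], AuxCut24M13Pos.cutValid, AuxCut24M13Neg.cutValid⟩
  · right
    rw [← ratCast_B24]
    exact ⟨26, 23, by norm_num [T24], by norm_num [T24], (AuxCut24P14Pos.cutValid.mono one_le_B24 B24_le_oldB), AuxCut24M14Neg.cutValid⟩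
  · right
    rw [← ratCast_B24]
    exact ⟨24, 24, by norm_num [T24], by norm_num [T24], AuxCut24M15Pos.cutValid, AuxCut24M15Neg.cutValid⟩
  · right
    rw [← ratCast_B24]
    exact ⟨23, 27, by norm_num [T24], by norm_num [T24], AuxCut24L16Pos.cutValid, AuxCut24M16Neg.cutValid⟩
  · right
    rw [← ratCast_B24]
    exact ⟨29, 29, by norm_num [T24], by norm_num [T24], AuxCut24M17Pos.cutValid, AuxCut24M17Neg.cutValid⟩
  · left; norm_num [T24]
  · left; norm_num [T24]
  · right
    rw [← ratCast_B24]
    exact ⟨37, 40, by norm_num [T24], by norm_num [T24], AuxCut24N20Pos.cutValid, AuxCut24M20Neg.cutValid⟩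
  · left; norm_num [T24]
  · left; norm_num [T24]
  · left; norm_num [T24]
  · left; norm_num [T24]
  · left; norm_num [T24]
  · left; norm_num [T24]
  · left; norm_num [T24]
  · left; norm_num [T24]
  · left; norm_num [T24]
  · left; norm_num [T24]

/-- Every certified auxiliary cut of the search table is valid for `(d, B) = (12, 20/17)` (one certificate file each; the files
`AuxCut24P…` certified at `61/50` are transported to `20/17` by `CutValidAL.mono`). -/
theorem cutTableValidAL_CT24al : CutTableValidAL 12 (((20 : ℕ) : ℝ) / ((17 : ℕ) : ℝ)) CT24al := by
  rw [← ratCast_B24]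
  intro k hk1 hk2 c hc
  have hk : k ≤ 12 := hk2
  interval_cases k
  · simp [CT24al] at hc
    rcases hc with rfl | rfl
    · exact (AuxCut24P1Pos.cutValid.mono one_le_B24 B24_le_oldB)
    · exact (AuxCut24P1Neg.cutValid.mono one_le_B24 B24_le_oldB)
  · simp [CT24al] at hc
    rcases hc with rfl | rfl
    · exact AuxCut24Lb2Pos.cutValid
    · exact AuxCut24Lb2Neg.cutValid
  · simp [CT24al] at hc
    rcases hc with rfl | rfl
    · exact (AuxCut24P3Pos.cutValid.mono one_le_B24 B24_le_oldB)
    · exact (AuxCut24P3Neg.cutValid.mono one_le_B24 B24_le_oldB)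
  · simp [CT24al] at hc
    rcases hc with rfl | rfl
    · exact AuxCut24N4Pos.cutValid
    · exact (AuxCut24P4Neg.cutValid.mono one_le_B24 B24_le_oldB)
  · simp [CT24al] at hc
    rcases hc with rfl | rfl
    · exact AuxCut24L5Pos.cutValid
    · exact AuxCut24L5Neg.cutValid
  · simp [CT24al] at hc
    rcases hc with rfl | rfl
    · exact AuxCut24M6Pos.cutValid
    · exact AuxCut24L6Neg.cutValid
  · simp [CT24al] at hc
    rcases hc with rfl | rfl
    · exact AuxCut24M7Pos.cutValid
    · exact AuxCut24M7Neg.cutValid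
  · simp [CT24al] at hc
    rcases hc with rfl | rfl
    · exact AuxCut24N8Pos.cutValid
    · exact AuxCut24M8Neg.cutValid
  · simp [CT24al] at hc
    rcases hc with rfl | rfl
    · exact AuxCut24L9Pos.cutValid
    · exact AuxCut24L9Neg.cutValid
  · simp [CT24al] at hc
    rcases hc with rfl | rfl
    · exact AuxCut24M10Pos.cutValid
    · exact AuxCut24M10Neg.cutValid
  · simp [CT24al] at hc
    rcases hc with rfl | rfl
    · exact AuxCut24L11Pos.cutValid
    · exact AuxCut24L11Neg.cutValid
  · simp [CT24al] at hc
    rcases hc with rfl | rfl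
    · exact AuxCut24N12Pos.cutValid
    · exact AuxCut24M12Neg.cutValid

/-- **Every cut of the combined table `CT24` is valid** for `(d, B) = (12, 20/17)`. -/
theorem cutTableValidX_CT24 : CutTableValidX 12 (((20 : ℕ) : ℝ) / ((17 : ℕ) : ℝ)) CT24 := by
  rw [← CT24_eq_merge]
  exact cutTableValidX_merge (cutTableValidTR_of_check cutTableCheckTR_CT24tr) cutTableValidAL_CT24al

/-- Every survivor with `c₁ ≥ 0` of the degree-24 search (with cuts) is certified. -/
theorem certified24 : ∀ a ∈ censusSearchC T24 CT24 12 [] [], 0 ≤ a.getD 0 0 →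
    ∃ c, checkCertX 20 17 12 coresDeg24 LC24 (1 :: palC a) c = true := by
  intro a ha hsign
  rw [show censusSearchC T24 CT24 12 [] [] = censusSearchC T24 CT24 12 [] (psumsRev [] 0) from rfl,
    mem_censusSearchC_node_iff (pre := []) (n := 0) rfl, (by decide +kernel : nodeLoC T24 CT24 [] (psumsRev [] 0) = -2),
    (by decide +kernel : nodeHiC T24 CT24 [] (psumsRev [] 0) = 2)] at ha
  obtain ⟨a1, ha1, ha⟩ := ha
  simp only [List.nil_append, Nat.reduceAdd] at ha
  rw [getD_zero_of_mem_censusSearchC_cons ha] at hsign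
  rw [mem_icc] at ha1
  obtain ⟨hlo1, hhi1⟩ := ha1
  interval_cases a1
  · rw [mem_censusSearchC_node_iff (pre := [0]) (n := 1) rfl,
      (by decide +kernel : nodeLoC T24 CT24 [0] (psumsRev [0] 1) = -1),
      (by decide +kernel : nodeHiC T24 CT24 [0] (psumsRev [0] 1) = 1)] at ha
    obtain ⟨a2, ha2, ha⟩ := ha
    simp only [List.cons_append, List.nil_append, Nat.reduceAdd] at ha
    rw [mem_icc] at ha2
    obtain ⟨hlo2, hhi2⟩ := ha2
    interval_cases a2
    · exact certified24n_p0_m1 a ha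
    · exact certified24n_p0_p0 a ha
    · exact certified24n_p0_p1 a ha
  · rw [mem_censusSearchC_node_iff (pre := [1]) (n := 1) rfl,
      (by decide +kernel : nodeLoC T24 CT24 [1] (psumsRev [1] 1) = -1),
      (by decide +kernel : nodeHiC T24 CT24 [1] (psumsRev [1] 1) = 2)] at ha
    obtain ⟨a2, ha2, ha⟩ := ha
    simp only [List.cons_append, List.nil_append, Nat.reduceAdd] at ha
    rw [mem_icc] at ha2
    obtain ⟨hlo2, hhi2⟩ := ha2
    interval_cases a2
    · exact certified24n_p1_m1 a ha
    · exact certified24n_p1_p0 a ha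
    · exact certified24n_p1_p1 a ha
    · exact certified24n_p1_p2 a ha
  · rw [mem_censusSearchC_node_iff (pre := [2]) (n := 1) rfl,
      (by decide +kernel : nodeLoC T24 CT24 [2] (psumsRev [2] 1) = 1),
      (by decide +kernel : nodeHiC T24 CT24 [2] (psumsRev [2] 1) = 3)] at ha
    obtain ⟨a2, ha2, ha⟩ := ha
    simp only [List.cons_append, List.nil_append, Nat.reduceAdd] at ha
    rw [mem_icc] at ha2
    obtain ⟨hlo2, hhi2⟩ := ha2
    interval_cases a2
    · exact certified24n_p2_p1 a ha
    · exact certified24n_p2_p2 a ha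
    · exact certified24n_p2_p3 a ha

/-- **Degree-24 census below `20/17` (kernel theorem):** `DegreeCensus 24 (20/17) coresDeg24` — every irreducible
`P ∈ ℤ[X]` of degree `24` with `1 < M(P) < 20/17` is `± c(± x)` for one of the 57 listed census cores of `coresDeg24`
(none of which lies below `20/17`: all have `M > 1.1883`, `coresDeg24_gap`), i.e. NO irreducible integer polynomial of degree 24
has `1 < M < 20/17` — Lehmer's bound at degree 24, inside the kernel; CONTROL/replication row (print complete to degree 44). -/
theorem degreeCensus_twentyfour : DegreeCensus 24 (20 / 17) coresDeg24 := by
  have h := degreeCensus_of_certified_nonnegXC (Bn := 20) (Bd := 17) (d := 12) (by norm_num) (by norm_num) (by norm_num)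
    (by decide) thresholdsValidX_T24 cutTableValidX_CT24 leafCutsValid_LC24 (by have := smythTheta_gt; push_cast; linarith)
    certified24
  norm_num at h
  exact h

open Literature.NumberTheory.MahlerMeasure

/-- **Degree-24 census below the Lehmer bound `20/17`, tight form: the list is EMPTY** — no irreducible `P ∈ ℤ[X]` of
degree `24` has `1 < M(P) < 20/17` (the 57 listed cores all have `M > 1.1883 > 20/17` by their kernel enclosures, `coresDeg24_gap`). -/
theorem degreeCensus_twentyfour_lehmer : DegreeCensus 24 (20 / 17) [] := by
  intro p hdeg hirr h1 hB
  obtain ⟨l, hl, hform⟩ := degreeCensus_twentyfour p hdeg hirr h1 hB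
  have hM := intMahlerMeasure_of_census_form hform
  have hgap := coresDeg24_gap l hl
  rw [hM] at hB
  exfalso
  linarith

/-- An irreducible `P` of degree `24` with `M(P) > 1` has `M(P) ≥ M(ℓ)` (in fact `M(P) ≥ 20/17 > M(ℓ)`). -/
theorem lehmer_le_of_irreducible_degree_twentyfour {P : ℤ[X]} (hirr : Irreducible P) (hdeg : P.natDegree = 24)
    (h1 : 1 < intMahlerMeasure P) : intMahlerMeasure lehmerPoly ≤ intMahlerMeasure P := by
  have hL : intMahlerMeasure lehmerPoly < 20 / 17 := lt_trans lehmer_measure_upper_bound (by norm_num)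
  by_cases h : intMahlerMeasure P < 20 / 17
  · obtain ⟨l, hl, -⟩ := degreeCensus_twentyfour_lehmer P hdeg hirr h1 h
    simp at hl
  · push Not at h
    exact le_trans (le_of_lt hL) h

/-- **Irreducible polynomials of degree `≤ 25` satisfy Lehmer's bound.** -/
theorem lehmer_le_of_irreducible_of_natDegree_le_twentyfive {P : ℤ[X]} (hirr : Irreducible P)
    (hdeg : P.natDegree ≤ 25) (h1 : 1 < intMahlerMeasure P) :
    intMahlerMeasure lehmerPoly ≤ intMahlerMeasure P := by
  by_cases h23 : P.natDegree ≤ 23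
  · exact lehmer_le_of_irreducible_of_natDegree_le_twentythree hirr h23 h1
  by_cases hB : 20 / 17 ≤ intMahlerMeasure P
  · exact le_trans (le_of_lt (lt_trans lehmer_measure_upper_bound (by norm_num))) hB
  push Not at h23 hB
  have hθ : intMahlerMeasure P < smythTheta := lt_trans hB (lt_trans (by norm_num) smythTheta_gt)
  obtain ⟨-, ⟨j, hj⟩, -⟩ := reciprocal_of_measure_lt_smythTheta hirr h1 hθ
  have hd : P.natDegree = 24 := by omega
  exact lehmer_le_of_irreducible_degree_twentyfour hirr hd h1

/-- **Lehmer's conjecture holds for every integer polynomial of degree `≤ 25`:** `M(P) > 1 ⇒ M(P) ≥ M(ℓ)`. -/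
theorem lehmer_le_of_natDegree_le_twentyfive {p : ℤ[X]} (hdeg : p.natDegree ≤ 25) (h1 : 1 < intMahlerMeasure p) :
    intMahlerMeasure lehmerPoly ≤ intMahlerMeasure p := by
  classical
  have hp : p ≠ 0 := by
    intro h
    rw [h] at h1
    unfold intMahlerMeasure at h1
    rw [Polynomial.map_zero, mahlerMeasure_zero] at h1
    linarith
  obtain ⟨u, hu⟩ := UniqueFactorizationMonoid.factors_prod hp
  obtain ⟨c, hc, hcu⟩ := Polynomial.isUnit_iff.mp u.isUnit
  set F := UniqueFactorizationMonoid.factors p with hF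
  have hFirr : ∀ f ∈ F, Irreducible f := fun f hf => UniqueFactorizationMonoid.irreducible_of_factor f hf
  have hMu : intMahlerMeasure (↑u : ℤ[X]) = 1 := by
    rw [← hcu, intMahlerMeasure_C]
    rcases Int.isUnit_iff.mp hc with h | h <;> simp [h]
  have hMp : intMahlerMeasure p = (F.map intMahlerMeasure).prod := by
    rw [← hu, intMahlerMeasure_mul, hMu, mul_one, intMahlerMeasure_multiset_prod]
  have hdvd : ∀ f ∈ F, f ∣ p := fun f hf => (Multiset.dvd_prod hf).trans ⟨↑u, hu.symm⟩
  have hge1 : ∀ x ∈ F.map intMahlerMeasure, 1 ≤ x := by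
    intro x hx
    obtain ⟨f, hf, rfl⟩ := Multiset.mem_map.mp hx
    exact one_le_intMahlerMeasure (hFirr f hf).ne_zero
  have hprod_ge : ∀ x ∈ F.map intMahlerMeasure, x ≤ (F.map intMahlerMeasure).prod := by
    intro x hx
    obtain ⟨T, hT⟩ := Multiset.exists_cons_of_mem hx
    rw [hT, Multiset.prod_cons]
    have hT1 : 1 ≤ T.prod :=
      Multiset.one_le_prod (fun y hy => hge1 y (by rw [hT]; exact Multiset.mem_cons_of_mem hy))
    have hx0 : 0 ≤ x := le_trans zero_le_one (hge1 x hx)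
    nlinarith
  by_contra hlt
  push Not at hlt
  have hall : ∀ x ∈ F.map intMahlerMeasure, x = 1 := by
    intro x hx
    obtain ⟨f, hf, rfl⟩ := Multiset.mem_map.mp hx
    by_contra hne
    have hgt : 1 < intMahlerMeasure f := lt_of_le_of_ne (hge1 _ hx) (Ne.symm hne)
    have hfdeg : f.natDegree ≤ 25 := (natDegree_le_of_dvd (hdvd f hf) hp).trans hdeg
    have h2 := lehmer_le_of_irreducible_of_natDegree_le_twentyfive (hFirr f hf) hfdeg hgt
    have h3 := hprod_ge _ hx
    rw [← hMp] at h3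
    linarith
  have : (F.map intMahlerMeasure).prod = 1 := Multiset.prod_eq_one hall
  rw [← hMp] at this
  linarith

/-- **A sub-Lehmer polynomial has degree at least `26`.** -/
theorem twentysix_le_natDegree_of_subLehmer {P : ℤ[X]} (hP : SubLehmer P) : 26 ≤ P.natDegree := by
  by_contra h
  push Not at h
  have := lehmer_le_of_natDegree_le_twentyfive (p := P) (by omega) hP.1
  exact absurd hP.2 (not_lt.mpr this)

/-- Census rows in the engines' format, degrees `≤ 25`, below Lehmer's measure: nothing. -/
theorem heightBoundedCensus_subLehmer_of_le_twentyfive {n h : ℕ} (hn : n ≤ 25) :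
    HeightBoundedCensus n h (intMahlerMeasure lehmerPoly) [] := by
  refine ⟨fun p hdeg _ h1 h2 => ?_, fun l hl => by simp at hl⟩
  exfalso
  have := lehmer_le_of_natDegree_le_twentyfive (p := p) (by omega) h1
  linarith

/-- **Rungs `N ≤ 25` of the sub-Lehmer ladder, unconditionally, at every height bound `h`.** -/
theorem heightSubLehmerEmptyUpTo_of_le_twentyfive (h : ℕ) {N : ℕ} (hN : N ≤ 25) : HeightSubLehmerEmptyUpTo h N := by
  intro P hdeg _ hP
  have := twentysix_le_natDegree_of_subLehmer hP
  omega

/-- Height-1 rungs `N ≤ 25`, unconditionally. -/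
theorem height1SubLehmerEmptyUpTo_of_le_twentyfive {N : ℕ} (hN : N ≤ 25) : Height1SubLehmerEmptyUpTo N :=
  (heightSubLehmerEmptyUpTo_one_iff N).mp (heightSubLehmerEmptyUpTo_of_le_twentyfive 1 hN)

/-- Every cell `HeightCell h s d` with core degree `d ≤ 25` holds unconditionally. -/
theorem heightCell_of_le_twentyfive (h : ℕ) (s : Multiset ℕ) {d : ℕ} (hd : d ≤ 25) : HeightCell h s d := by
  intro Q hdeg _ _ _ _ _ hQ
  have := twentysix_le_natDegree_of_subLehmer hQ
  omega

/-- **The kernel census of small Mahler measures, degrees `1 … 25`:** the rows of `kernelCensus_le_twentythree` (bound `13/10`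
for `n ≤ 21` and `n = 23`, `61/50` at `n = 22`), the EMPTY degree-24 row at the Lehmer bound `20/17` and the empty row of the odd degree `25`. -/
theorem kernelCensus_le_twentyfive :
    ((DegreeCensus 8 (13 / 10) coresDeg8 ∧ DegreeCensus 10 (13 / 10) coresDeg10 ∧ DegreeCensus 12 (13 / 10) coresDeg12 ∧
      DegreeCensus 14 (13 / 10) coresDeg14 ∧ DegreeCensus 16 (13 / 10) coresDeg16 ∧ DegreeCensus 18 (13 / 10) coresDeg18 ∧
      DegreeCensus 20 (13 / 10) coresDeg20 ∧
      ∀ n : ℕ, 1 ≤ n → n ≤ 21 → n ≠ 8 → n ≠ 10 → n ≠ 12 → n ≠ 14 → n ≠ 16 → n ≠ 18 → n ≠ 20 →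
        DegreeCensus n (13 / 10) []) ∧
    DegreeCensus 22 (61 / 50) [c22_01] ∧ DegreeCensus 23 (13 / 10) []) ∧
    DegreeCensus 24 (20 / 17) [] ∧ DegreeCensus 25 (13 / 10) [] := by
  refine ⟨kernelCensus_le_twentythree, degreeCensus_twentyfour_lehmer, ?_⟩
  have hθ : (13 : ℝ) / 10 ≤ smythTheta := le_of_lt (lt_trans (by norm_num) smythTheta_gt)
  exact degreeCensus_odd_smythTheta (by decide) hθ

end Summit.Ventures.DiscreteObjects.Mahler
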